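import Summits.MatrixMultiplication.MatrixMultiplication.Theses.EPRFaces

/-!
# MatrixMultiplication / EPRFaces — `Dichotomy` (stmt-MatrixMultiplication-10897)

Route `EPRFaces`, support item `Dichotomy` (the card's dichotomy lemma, record-free):
IF the VXXZ2024 row `κ = 3` holds in rank form, `∀ ε > 0, R(⟨n,n,n³⟩) = O(n^{4.198809+ε})`
(i.e. `ω(1,1,3) ≤ 4.198809`, kept as an explicit hypothesis so that no vendored table enters the
route's cone), AND the face-maximiser statement `B` holds (every admissible `β` for shape `(1,1,k)`
satisfies `ω + (k − 1) ≤ β`), THEN `ω ≤ 2.198809`.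

Proof: for every `ε > 0` the row gives the admissible exponent `β = 4.198809 + ε/2` for `k = 3`;
`B` at `k = 3` turns it into `ω + 2 ≤ 4.198809 + ε/2`, so `ω < 2.198809 + ε`; conclude with
`le_of_forall_pos_lt_add`.
-/

-- the tree's namespace `Summit.MatrixMultiplication.MatrixMultiplication.…` repeats a component by design
set_option linter.dupNamespace false

namespace Summit.MatrixMultiplication.MatrixMultiplication.Theorems

open Summit.MatrixMultiplication.MatrixMultiplication.Theses.EPRFaces

/-- **Dichotomy** (route EPRFaces, stmt-MatrixMultiplication-10897): the rank-form VXXZ2024 row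
`ω(1,1,3) ≤ 4.198809` together with the face-maximiser statement `B` (`ω + (k − 1) ≤ β` for every
admissible `β` of shape `(1,1,k)`) forces `ω ≤ 2.198809` (take `k = 3`, `β = 4.198809 + ε/2`,
`ε → 0`). Contrapositively, `ω > 2.198809` makes every `ω`-maximising spectral point interior. -/
theorem dichotomy_proof :
    Summit.MatrixMultiplication.MatrixMultiplication.Theses.EPRFaces.Dichotomy := by
  unfold Dichotomy
  intro hRow hB
  refine le_of_forall_pos_lt_add fun ε hε => ?_
  have h := hB 3 (by norm_num) ((4.198809 : ℝ) + ε / 2) (hRow (ε / 2) (half_pos hε))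
  norm_num at h
  linarith

end Summit.MatrixMultiplication.MatrixMultiplication.Theorems
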